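import Summits.AtomisticToContinuum.Crystallization.Theorems.ChargedEnergyGapAffineStabilityFcc
import Literature.MathematicalPhysics.StatisticalMechanics.BarlowBilayers
import HarnessLib

/-!
# ChargedEnergyGap · «AffineStabilityFcc» §S5 — the fcc CLASS: constant Hägg words, the (U-f) scale statement `Fcc.FccStressFreeScale`,
# and CLASS-level [A-i]ᶠ modulo (U-f) (lens-3 g67 ASF v3 660220018ac2fc50, l.385–491 VERBATIM; sequel module of `…ChargedEnergyGapAffineStabilityFcc`)

Landed as a SEQUEL MODULE (not an append) because of the gate's 400-line cap on Theorems files with proofs (`lint.statement-form`), per critic row 1281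
(3)(b): «§S5 as a SEQUEL MODULE …/ChargedEnergyGapAffineStabilityFccClass.lean = v3 l.385–491 verbatim under imports …ChargedEnergyGapAffineStabilityFcc +
Literature…BarlowBilayers (+ HarnessLib), namespace …ChartDial.Fcc».  The module docstring of `…ChargedEnergyGapAffineStabilityFcc` (§S1–§S4, v2 71f7889a =
v3 l.1–384) describes the node; this part: `Fcc.exists_isometry_eq_image_fccStacking` (constant-letter word ⇒ isometric image of `fccStacking a h`), the (U-f)
certificate statement `Fcc.FccStressFreeScale`, and ★★ `Fcc.sitewiseAffineStability_fccClass_of_scale` (CLASS-level [A-i]ᶠ, κ = 3/8, modulo (U-f)).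
Same namespace; all FQNs as in v3.  0 sorry; standard axioms.  (landing lane hand-2 g34)
-/

noncomputable section

open scoped Classical
open Literature.MathematicalPhysics.StatisticalMechanics Literature.Geometry.DiscreteGeometry
open Summit.AtomisticToContinuum.Crystallization.Theses.PricedLinkCensus
open Summit.AtomisticToContinuum.Crystallization.Theorems.ChargedEnergyGapNegative

namespace Summit.AtomisticToContinuum.Crystallization.Theorems.ChargedEnergyGapChartDial

namespace Fcc

/-! ## §S5 The fcc CLASS: constant Hägg words, the (U-f) scale statement, and CLASS-level [A-i]ᶠ modulo (U-f)

A constant Hägg word is `≡ 1` (the stacking IS `fccStacking a h`) or `≡ −1` (the stacking is the BASAL MIRROR image of `fccStacking a h`,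
`barlowPos_eq_mirror_translate_fcc` with `haggLabel s k = −k`); so every fcc-class Barlow image is an isometric image of some `fccStacking a h`
with `(a, h)` in the window.  (U-f) `FccStressFreeScale` — the ONE remaining certificate — says a site-stress-free such image has the ideal
ratio `h = hOf a = a√(2/3)` and the stress-free scale `bOf a = a₀` (floats: unique virial zero in the window, exterior margin ≈ 0.5, memo §8);
given it, `image_rot_fcc` + §S4 yield [A-i] (κ = 3/8) at every site of every site-stress-free fcc-class reference. -/

/-- A word with `s (i+1) = s i` for all `i` is constant. -/
theorem word_const_of_succ_eq {s : ℤ → ℤ} (hs : ∀ i, s (i + 1) = s i) (i : ℤ) : s i = s 0 := by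
  induction i with
  | zero => rfl
  | succ n ih => rw [hs, ih]
  | pred n ih =>
    have h := hs (-(n : ℤ) - 1)
    rw [sub_add_cancel] at h
    rw [← ih, ← h]

/-- The layer label of a constant word: `haggLabel s k = s 0 · k`. -/
theorem haggLabel_of_succ_eq {s : ℤ → ℤ} (hs : ∀ i, s (i + 1) = s i) (k : ℤ) : haggLabel s k = s 0 * k := by
  induction k with
  | zero => simp
  | succ n ih => rw [haggLabel_succ, ih, word_const_of_succ_eq hs (n : ℤ)]; ring
  | pred n ih =>
    have h := haggLabel_succ s (-(n : ℤ) - 1)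
    rw [sub_add_cancel, ih, word_const_of_succ_eq hs (-(n : ℤ) - 1)] at h
    linear_combination -h

/-- Word `≡ 1`: the stacking is the fcc stacking itself. -/
theorem barlowStacking_eq_fcc_of_word_one {s : ℤ → ℤ} (h1 : ∀ i, s i = 1) (a h : ℝ) :
    barlowStacking a h s = fccStacking a h := by
  have hs : s = constHagg := funext fun i => by rw [h1]; rfl
  subst hs; rfl

/-- Word `≡ −1`: the stacking is the basal-mirror image of the fcc stacking. -/
theorem barlowStacking_eq_mirror_fcc_of_word_neg_one {s : ℤ → ℤ} (h1 : ∀ i, s i = -1) (a h : ℝ) :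
    barlowStacking a h s = basalMirror '' fccStacking a h := by
  have hs : ∀ i, s (i + 1) = s i := fun i => by rw [h1, h1]
  have hL : ∀ k : ℤ, (haggLabel s k : ℝ) + k = 0 := fun k => by
    rw [haggLabel_of_succ_eq hs, h1 0]; push_cast; ring
  have hpos : ∀ k i j : ℤ, barlowPos a h s k i j = basalMirror (barlowPos a h constHagg (-k) i j) := fun k i j => by
    rw [barlowPos_eq_mirror_translate_fcc, hL, zero_smul, add_zero]
  ext x
  constructor
  · rintro ⟨k, i, j, rfl⟩
    exact ⟨barlowPos a h constHagg (-k) i j, ⟨-k, i, j, rfl⟩, (hpos k i j).symm⟩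
  · rintro ⟨_, ⟨k, i, j, rfl⟩, rfl⟩
    refine ⟨-k, i, j, ?_⟩
    rw [hpos, neg_neg]

/-- ★ NORMAL FORM of the fcc class: a Hägg word with constant letters codes an ISOMETRIC IMAGE of `fccStacking a h` (identity or basal mirror). -/
theorem exists_isometry_eq_image_fccStacking {s : ℤ → ℤ} (hH : IsHaggSeq s) (hs : ∀ i, s (i + 1) = s i) (a h : ℝ) :
    ∃ g₀ : E3 → E3, Isometry g₀ ∧ barlowStacking a h s = g₀ '' fccStacking a h := by
  rcases hH 0 with h0 | h0
  · refine ⟨id, isometry_id, ?_⟩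
    rw [Set.image_id, barlowStacking_eq_fcc_of_word_one fun i => (word_const_of_succ_eq hs i).trans h0]
  · exact ⟨basalMirror, basalMirror.isometry,
      barlowStacking_eq_mirror_fcc_of_word_neg_one (fun i => (word_const_of_succ_eq hs i).trans h0) a h⟩

/-- The tree's rotation `rot` (stacking ↦ cubic coordinates) as a linear isometry equivalence. -/
def rotEquiv : E3 ≃ₗᵢ[ℝ] E3 :=
  LinearIsometry.toLinearIsometryEquiv { toLinearMap := rot, norm_map' := norm_rot } rfl

/-- Pointwise form of `rotEquiv`. -/
theorem rotEquiv_apply (z : E3) : rotEquiv z = rot z :=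
  LinearIsometry.toLinearIsometryEquiv_apply _ rfl z

/-- The fcc stacking at the ideal ratio is the INVERSE-rotated cubic reference `b·D₃`, `b = bOf a` (from the tree's `image_rot_fcc`). -/
theorem fccStacking_eq_image_symm_fccRef {a : ℝ} (ha : 0 < a) :
    fccStacking a (hOf a) = rotEquiv.symm '' (fccRef (bOf a) (bOf_pos ha)).points := by
  rw [← image_rot_fcc a ha, Set.image_image]
  ext x
  simp only [Set.mem_image]
  constructor
  · intro hx; exact ⟨x, hx, by rw [← rotEquiv_apply, LinearIsometryEquiv.symm_apply_apply]⟩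
  · rintro ⟨y, hy, rfl⟩; rwa [← rotEquiv_apply, LinearIsometryEquiv.symm_apply_apply]

/-- `fccRef` does not depend on the positivity witness, and equal scales give equal references. -/
theorem fccRef_congr {b b' : ℝ} (hb : 0 < b) (hb' : 0 < b') (e : b = b') : fccRef b hb = fccRef b' hb' := by
  subst e; rfl

/-- ★ piece (U-f) · UNDECIDED · TRUE-leaning · CERT-able (floats, memo §8: unique virial zero in the window at `(a₀√2, a₀√2·√(2/3))`, Jacobian
det ≈ 820, exterior margin `min max(|T∥|, |T⊥|) ≈ 0.54`) · **THE STRESS-FREE SCALE OF THE fcc CLASS** (the one remaining certificate of the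
class-level [A-i]ᶠ): a site-stress-free periodic presentation of an isometric image of `fccStacking a h`, `(a, h)` in the Barlow window, has the
ideal ratio `h = a√(2/3)` and the Lennard-Jones stress-free scale `a/√2 = a₀`.  Why it might fail: only through a second zero of the two-component
site virial `(T∥, T⊥)(a, h)` of the rhombohedral ABC family inside the window (none numerically). -/
def FccStressFreeScale : Prop :=
  ∀ (P : PeriodicConfiguration 3) (a h : ℝ) (g : E3 → E3),
    (9 / 10 ≤ a ∧ a ≤ 11 / 10) → (0 < h ∧ 27 / 50 * a ^ 2 ≤ h ^ 2 ∧ h ^ 2 ≤ 121 / 150 * a ^ 2) →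
    Isometry g → P.points = g '' fccStacking a h → IsSiteStressFree P → h = hOf a ∧ bOf a = a0

/-- ★★ CLASS-LEVEL [A-i]ᶠ MODULO (U-f): given `FccStressFreeScale`, EVERY site-stress-free periodic presentation of an fcc-class Barlow image
(word with constant letters, window) satisfies the sitewise affine stability inequality with κ = 3/8 at every one of its points. -/
theorem sitewiseAffineStability_fccClass_of_scale (hU : FccStressFreeScale) (P : PeriodicConfiguration 3) {a h : ℝ} {s : ℤ → ℤ}
    {g : E3 → E3} (ha : 9 / 10 ≤ a ∧ a ≤ 11 / 10) (hh : 0 < h ∧ 27 / 50 * a ^ 2 ≤ h ^ 2 ∧ h ^ 2 ≤ 121 / 150 * a ^ 2)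
    (hH : IsHaggSeq s) (hs : ∀ i, s (i + 1) = s i) (hg : Isometry g) (hP : P.points = g '' barlowStacking a h s)
    (hS : IsSiteStressFree P) :
    ∀ y ∈ P.points, ∀ (A : E3 →ₗ[ℝ] E3) (u : E3), ‖u‖ = 1 → (3 / 8) * inner ℝ u (A u) ^ 2 ≤ quadSite (affineField A) P ∅ y := by
  obtain ⟨g₀, hg₀, hst⟩ := exists_isometry_eq_image_fccStacking hH hs a h
  have hP₁ : P.points = (fun x => g (g₀ x)) '' fccStacking a h := by rw [hP, hst, Set.image_image]
  have hI₁ : Isometry fun x => g (g₀ x) := hg.comp hg₀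
  obtain ⟨hhO, hb⟩ := hU P a h (fun x => g (g₀ x)) ha hh hI₁ hP₁ hS
  have ha0 : 0 < a := by linarith [ha.1]
  have hP₂ : P.points = (fun x => g (g₀ (rotEquiv.symm x))) '' (fccRef a0 a0_pos).points := by
    rw [hP₁, hhO, fccStacking_eq_image_symm_fccRef ha0, Set.image_image, fccRef_congr (bOf_pos ha0) a0_pos hb]
  exact sitewiseAffineStability_of_isometricImage_fccRef_a0 P (hI₁.comp rotEquiv.symm.isometry) hP₂

end Fcc

end Summit.AtomisticToContinuum.Crystallization.Theorems.ChargedEnergyGapChartDial
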